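import Summits.SmoothPoincare4.SmoothPoincare4.Theses.InformationMetricHadamard
import Summits.SmoothPoincare4.SmoothPoincare4.Theorems.InformationMetricHadamardC0AhRecognitionStubFarCollarPackage
import Summits.SmoothPoincare4.SmoothPoincare4.Theorems.InformationMetricHadamardC0AhRecognitionStubNearLevelSectionAux1
import Summits.SmoothPoincare4.SmoothPoincare4.Theorems.InformationMetricHadamardC0AhRecognitionStubNearLevelSectionAux3

/-!
# Line `core-distance-morse`, crux `InformationMetricHadamard.C0AhRecognition` (stmt-SmoothPoincare4-6015) — stub `stub_nearLevelSection`

The tiny level `{d_G(·, K_s) = a}` of the distance to the far core `K_s = (Ψ(N × (0,s)))ᶜ` of an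
end collar is a smooth injectively immersed copy of the cross-section `N`: assemble the inward unit
normal of the slice `Ψ(·, s)` (`helper_nearLevelSection_1`), the slice package of stub P
(`FarCollarPackage.injective_slice`, `FarCollarPackage.mfderiv_slice_injective`) and the one-sided
tubular level theorem (`helper_nearLevelSection_3`, via the calibrated tube of
`helper_nearLevelSection_2`); the empty cross-section is trivial (`K_s = W`, the level is empty).

Everything is proved (kind = proof); no definitions.
-/

noncomputable section

-- the prescribed namespace `Summit.<P>.<Sub>.…` duplicates `SmoothPoincare4` (P = Sub)
set_option linter.dupNamespace false

open scoped Manifold ContDiff Topology ENNReal NNReal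
open Set Function Filter

namespace Summit.SmoothPoincare4.SmoothPoincare4.Cruxes.C0AhRecognition.CoreDistanceMorse

open Literature.Topology.FourManifolds (HomotopySphere)
open Literature.Geometry.Lorentzian (PseudoRiemannianMetric)

/-- **Stub E2 (`nearLevelSection`, one-sided tubular level).** Let `(W, G)` be a complete Riemannian
5-manifold and `Ψ : N × ℝ → W` (`N` closed) smooth and injective on `N × (0,1)`, immersive on
`N × (0,t₀)`; let `s < t₀` be a level whose far part `Ψ(N × (0,s))` is open with closure
`Ψ(N × (0,s])`, whose far core `K_s = (Ψ(N × (0,s)))ᶜ` is compact with frontier the slice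
`{Ψ(y,s)}` (all supplied by stub P and the crux). Then for all sufficiently small `a > 0` the level
`{f = a}` of `f = d_G(·, K_s)` is the image of a smooth injective immersion `N → W`.
Proof: the slice is a compact embedded hypersurface with the smooth inward `G`-unit normal
`ν = -♯dλ/|♯dλ|` of the depth `λ = pr₂ ∘ Ψ⁻¹` (`helper_nearLevelSection_1`); `K_s` lies on the
backward side of it; the outward normal exponential map `E(y,a) = exp_{Ψ(y,s)}(a ν(y))`
parametrises `{f = a}` for `a` below a quarter of the width of the calibrated tube
(`helper_nearLevelSection_3`: Gauss lemma for hypersurfaces, first-exit arguments along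
almost-minimising paths); `j_a := E(·,a)`.
[cite: LeeRiemannianManifolds2018, Thm. 5.25 / Prop. 5.26 / Cor. 6.12] -/
theorem stub_nearLevelSection
    (N : Type) [TopologicalSpace N] [T2Space N] [SecondCountableTopology N] [CompactSpace N]
    [ChartedSpace (EuclideanSpace ℝ (Fin 4)) N] [IsManifold (𝓡 4) ∞ N]
    (W : Type) [TopologicalSpace W] [T2Space W] [SecondCountableTopology W]
    [ChartedSpace (EuclideanSpace ℝ (Fin 5)) W] [IsManifold (𝓡 5) ∞ W]
    (G : PseudoRiemannianMetric (𝓡 5) ∞ (EuclideanSpace ℝ (Fin 5)) (TangentSpace (𝓡 5) : W → Type _))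
    (hG : G.IsRiemannian)
    (hcpt : ∀ (x : W) (r : NNReal), IsCompact {y : W | G.edist hG x y ≤ r})
    (Ψ : N × ℝ → W)
    (hsm : ContMDiffOn ((𝓡 4).prod 𝓘(ℝ, ℝ)) (𝓡 5) ∞ Ψ (univ ×ˢ Ioo (0 : ℝ) 1))
    (hinj : InjOn Ψ (univ ×ˢ Ioo (0 : ℝ) 1))
    (t₀ : ℝ) (ht₀ : t₀ ∈ Ioo (0 : ℝ) 1)
    (himm : ∀ (y : N) (l : ℝ), l ∈ Ioo (0 : ℝ) t₀ →
      Injective (mfderiv ((𝓡 4).prod 𝓘(ℝ, ℝ)) (𝓡 5) Ψ (y, l)))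
    (s : ℝ) (hs : s ∈ Ioo (0 : ℝ) t₀)
    (hopen : IsOpen (Ψ '' (univ ×ˢ Ioo (0 : ℝ) s)))
    (hclos : closure (Ψ '' (univ ×ˢ Ioo (0 : ℝ) s)) = Ψ '' (univ ×ˢ Ioc (0 : ℝ) s))
    (hfront : frontier (Ψ '' (univ ×ˢ Ioo (0 : ℝ) s))ᶜ = range (fun y : N ↦ Ψ (y, s)))
    (hKc : IsCompact (Ψ '' (univ ×ˢ Ioo (0 : ℝ) s))ᶜ) :
    ∃ a₀ : ℝ, 0 < a₀ ∧ ∀ a ∈ Ioo (0 : ℝ) a₀, ∃ j : N → W,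
      ContMDiff (𝓡 4) (𝓡 5) ∞ j ∧ Injective j ∧
      (∀ x : N, Injective (mfderiv (𝓡 4) (𝓡 5) j x)) ∧
      range j = {y : W | ⨅ k ∈ (Ψ '' (univ ×ˢ Ioo (0 : ℝ) s))ᶜ, G.edist hG y k = ENNReal.ofReal a} := by
  -- the closure clause and the compactness of the core are not needed here
  have _ := hclos
  have _ := hKc
  clear hclos hKc
  -- the empty cross-section: `K_s = W`, `f ≡ 0`, and the level is empty
  rcases isEmpty_or_nonempty N with hN | hN
  · refine ⟨1, one_pos, fun a ha ↦ ⟨fun z ↦ isEmptyElim z, fun z ↦ isEmptyElim z,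
      fun z ↦ isEmptyElim z, fun z ↦ isEmptyElim z, ?_⟩⟩
    rw [Set.range_eq_empty]
    ext y
    simp only [mem_empty_iff_false, mem_setOf_eq, false_iff]
    intro hy
    have hyK : y ∈ (Ψ '' (univ ×ˢ Ioo (0 : ℝ) s))ᶜ := by
      rintro ⟨p, -, -⟩
      exact isEmptyElim p.1
    have h0 : (⨅ k ∈ (Ψ '' (univ ×ˢ Ioo (0 : ℝ) s))ᶜ, G.edist hG y k) ≤ 0 :=
      (iInf₂_le y hyK).trans (le_of_eq (PseudoRiemannianMetric.edist_self hG y))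
    rw [hy] at h0
    exact absurd (ENNReal.ofReal_pos.2 ha.1) (not_lt.2 h0)
  -- the inward unit normal of the slice and the slice package
  have hs1 : s ∈ Ioo (0 : ℝ) 1 := ⟨hs.1, hs.2.trans ht₀.2⟩
  obtain ⟨ν, hν, hunit, hperp, hside⟩ :=
    helper_nearLevelSection_1 N W G hG Ψ hsm hinj t₀ ht₀ himm s hs
  have hinjι : Injective (fun y : N ↦ Ψ (y, s)) := FarCollarPackage.injective_slice Ψ hinj hs1
  have himmι : ∀ y : N, Injective (mfderiv (𝓡 4) (𝓡 5) (fun y : N ↦ Ψ (y, s)) y) := fun y ↦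
    FarCollarPackage.mfderiv_slice_injective Ψ hsm hs1 y (himm y s hs)
  have hfr : frontier (Ψ '' (univ ×ˢ Ioo (0 : ℝ) s)) = range (fun y : N ↦ Ψ (y, s)) := by
    rw [← frontier_compl]
    exact hfront
  -- the backward side `Ψ(N × (s,t₀))` misses the far part (injectivity)
  have hside' : ∀ (z : N) (γ : ℝ → W), γ 0 = Ψ (z, s) → MDifferentiableAt 𝓘(ℝ, ℝ) (𝓡 5) γ 0 →
      mfderiv 𝓘(ℝ, ℝ) (𝓡 5) γ 0 1 = ν z →
      (∀ᶠ t in 𝓝[>] (0 : ℝ), γ t ∈ Ψ '' (univ ×ˢ Ioo (0 : ℝ) s)) ∧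
      (∀ᶠ t in 𝓝[<] (0 : ℝ), γ t ∉ Ψ '' (univ ×ˢ Ioo (0 : ℝ) s)) := by
    intro z γ h0 hd hv
    obtain ⟨h1, h2⟩ := hside z γ h0 hd hv
    refine ⟨h1, h2.mono fun t ht hU ↦ ?_⟩
    obtain ⟨p, hp, hpt⟩ := ht
    obtain ⟨q, hq, hqt⟩ := hU
    have hpq : p = q := hinj ⟨mem_univ _, hs.1.trans hp.2.1, hp.2.2.trans ht₀.2⟩
      ⟨mem_univ _, hq.2.1, hq.2.2.trans hs1.2⟩ (hpt.trans hqt.symm)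
    have hlt₁ : s < p.2 := hp.2.1
    have hlt₂ : q.2 < s := hq.2.2
    rw [hpq] at hlt₁
    exact lt_irrefl _ (hlt₁.trans hlt₂)
  -- the one-sided tubular level theorem
  exact helper_nearLevelSection_3 N W G hG hcpt (fun y : N ↦ Ψ (y, s)) hinjι himmι ν hν hunit hperp
    (Ψ '' (univ ×ˢ Ioo (0 : ℝ) s)) hopen hfr hside'

end Summit.SmoothPoincare4.SmoothPoincare4.Cruxes.C0AhRecognition.CoreDistanceMorse

end
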